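import Summits.BirchSwinnertonDyer.Rank1Residual.ManinAdditive.KatoShiftTwoLaws
import Summits.BirchSwinnertonDyer.BirchSwinnertonDyer.Theorems.ManinLocalTwoThreeMultiShiftSpanColumns
import HarnessLib

/-!
# Route `ManinLocalTwoThree`, crux C2 `ManinOddAtFour` (stmt-BirchSwinnertonDyer-22967), line `kato-shift-two`
# (es g7): the multi-shift generation law E-es-22 `MultiShiftClassGenerationTwo` BY NAME — it is equivalent to its
# prime-classwise form and to its `ℓ₀ = 0` instance (line prover p3; helper, unconditional edges)

By prime-class generation over the admissible primes (`periodLattice_le_closure_primeClass_admissibleTwo`,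
`…PrimeClassGeneration`), the fact that prime classes are periods (`primeClass_mem_periodLattice_of_lt`), and the
prime-free form of the multi-shift span (`multiShiftSpan_admissible_eq_of_le`, `…MultiShiftSpanColumns`):
* `multiShiftClassGenerationTwo_iff_primeClasswise` — E-es-22 (an odd multiple of `Λ_f` lies in the span of the
  multi-shift classes over admissible `ℓ ≥ ℓ₀`) holds iff some odd `m` puts `m·{0, a/ℓ}_f` in that span for every
  admissible `ℓ ≥ ℓ₀`, `0 < a < ℓ`;
* `multiShiftClassGenerationTwo_iff_zero` — E-es-22 holds iff its `ℓ₀ = 0` instance holds (the span of the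
  multi-shift classes over admissible `ℓ ≥ ℓ₀` does not depend on `ℓ₀`; REFUTER-ref1 §R38's remark on the cofinal
  `∀ ℓ₀` shape is thereby settled: the lever's `ℓ₀ = 0` consumption and the leaf's `∀ ℓ₀` statement coincide).
Nothing about BSD, Manin's conjecture or E-es-22 itself is proved here.
-/

set_option autoImplicit false
set_option linter.dupNamespace false

noncomputable section

open scoped Classical MatrixGroups ModularForm BigOperators

open CongruenceSubgroup WeierstrassCurve
  Literature.NumberTheory.EllipticCurves Literature.NumberTheory.EllipticCurves.ModularForms
  Summit.BirchSwinnertonDyer.Rank1Residual.ManinAdditive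

namespace Summit.BirchSwinnertonDyer.BirchSwinnertonDyer.Theorems.ManinLocalTwoThree

/-- **E-es-22 ⟺ its prime-classwise form.** The multi-shift generation law `MultiShiftClassGenerationTwo`
(CONJECTURE E-es-22: an odd multiple of `Λ_f` lies in the span of the multi-shift classes over admissible
`ℓ ≥ ℓ₀`) holds if and only if, for the same data, some odd `m` puts `m·{0, a/ℓ}_f` in that span for EVERY
admissible `ℓ ≥ ℓ₀` and `0 < a < ℓ`: `⟹` because prime classes are periods
(`primeClass_mem_periodLattice_of_lt`), `⟸` by prime-class generation over the admissible primes
(`periodLattice_le_closure_primeClass_admissibleTwo`). Nothing is asserted about E-es-22 itself. [folklore] -/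
theorem multiShiftClassGenerationTwo_iff_primeClasswise :
    MultiShiftClassGenerationTwo ↔
      ∀ (W : WeierstrassCurve ℚ) [W.IsElliptic] {N : ℕ} [NeZero N] (f : CuspForm (Gamma0 N) 2) (ℓ₀ : ℕ),
        IsNewformOf W f → 2 ^ 2 ∣ N → W.HasIrreducibleModPGaloisRep 2 →
        ∃ m : ℕ, ¬ 2 ∣ m ∧
          ∀ ℓ ∈ {ℓ : ℕ | ℓ₀ ≤ ℓ ∧ (ℓ.Prime ∧ ¬ ℓ ∣ N ∧ ℓ % 4 = 3 ∧
              ∀ t ∈ insert 8 (N.primeFactors.filter fun q => ¬ q ^ 2 ∣ N),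
                (t : ZMod ℓ) ≠ 1 ∧ (t : ZMod ℓ) ≠ -1)},
            ∀ a : ℕ, 0 < a → a < ℓ → (m : ℂ) * primeClass f ℓ a ∈ AddSubgroup.closure
              {z : ℂ | ∃ ℓ ∈ {ℓ : ℕ | ℓ₀ ≤ ℓ ∧ (ℓ.Prime ∧ ¬ ℓ ∣ N ∧ ℓ % 4 = 3 ∧
                  ∀ t ∈ insert 8 (N.primeFactors.filter fun q => ¬ q ^ 2 ∣ N),
                    (t : ZMod ℓ) ≠ 1 ∧ (t : ZMod ℓ) ≠ -1)},
                ∃ a : ℕ, 0 < a ∧ a < ℓ ∧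
                  z = ∑ T ∈ (insert 8 (N.primeFactors.filter fun q => ¬ q ^ 2 ∣ N)).powerset,
                        (-1 : ℂ) ^ T.card * primeClass f ℓ (a * ∏ t ∈ T, t)} := by
  constructor
  · intro H W _ N _ f ℓ₀ hf h4 hirr
    obtain ⟨m, hm, hgen⟩ := H W f ℓ₀ hf h4 hirr
    refine ⟨m, hm, fun ℓ hℓ a ha0 ha => hgen _ ?_⟩
    exact primeClass_mem_periodLattice_of_lt f hℓ.2.1 hℓ.2.2.1 ha0 ha
  · intro H W _ N _ f ℓ₀ hf h4 hirr
    obtain ⟨m, hm, hgen⟩ := H W f ℓ₀ hf h4 hirr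
    refine ⟨m, hm, fun z hz => ?_⟩
    have hz' := periodLattice_le_closure_primeClass_admissibleTwo f h4 ℓ₀ hz
    rw [← AddMonoidHom.coe_mulLeft, ← AddSubgroup.mem_comap]
    refine (AddSubgroup.closure_le _).mpr ?_ hz'
    rintro _ ⟨ℓ, hℓ, a, ha0, ha, rfl⟩
    rw [SetLike.mem_coe, AddSubgroup.mem_comap, AddMonoidHom.coe_mulLeft]
    exact hgen ℓ hℓ a ha0 ha

/-- **E-es-22 ⟺ its `ℓ₀ = 0` instance.** Since the span of the multi-shift classes over admissible primes `ℓ ≥ ℓ₀`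
does not depend on `ℓ₀` (`multiShiftSpan_admissible_eq_of_le`: it is the span of the column elements over all
second columns of `Γ₀(N)`), the cofinal law `MultiShiftClassGenerationTwo` (`∀ ℓ₀`) is equivalent to its single
instance `ℓ₀ = 0`. Nothing is asserted about E-es-22 itself. [folklore] -/
theorem multiShiftClassGenerationTwo_iff_zero :
    MultiShiftClassGenerationTwo ↔
      ∀ (W : WeierstrassCurve ℚ) [W.IsElliptic] {N : ℕ} [NeZero N] (f : CuspForm (Gamma0 N) 2),
        IsNewformOf W f → 2 ^ 2 ∣ N → W.HasIrreducibleModPGaloisRep 2 →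
        ∃ m : ℕ, ¬ 2 ∣ m ∧ ∀ z ∈ periodLattice f, (m : ℂ) * z ∈ AddSubgroup.closure
          {z : ℂ | ∃ ℓ ∈ {ℓ : ℕ | 0 ≤ ℓ ∧ (ℓ.Prime ∧ ¬ ℓ ∣ N ∧ ℓ % 4 = 3 ∧
              ∀ t ∈ insert 8 (N.primeFactors.filter fun q => ¬ q ^ 2 ∣ N),
                (t : ZMod ℓ) ≠ 1 ∧ (t : ZMod ℓ) ≠ -1)},
            ∃ a : ℕ, 0 < a ∧ a < ℓ ∧
              z = ∑ T ∈ (insert 8 (N.primeFactors.filter fun q => ¬ q ^ 2 ∣ N)).powerset,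
                    (-1 : ℂ) ^ T.card * primeClass f ℓ (a * ∏ t ∈ T, t)} := by
  constructor
  · intro H W _ N _ f hf h4 hirr
    exact H W f 0 hf h4 hirr
  · intro H W _ N _ f ℓ₀ hf h4 hirr
    obtain ⟨m, hm, hgen⟩ := H W f hf h4 hirr
    refine ⟨m, hm, fun z hz => ?_⟩
    have key := multiShiftSpan_admissible_eq_of_le f h4 ℓ₀ 0
    have h := hgen z hz
    simp only [primeClass] at h ⊢
    rw [key]
    exact h

end Summit.BirchSwinnertonDyer.BirchSwinnertonDyer.Theorems.ManinLocalTwoThree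

end
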